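import Literature.IUT.LogVolume.TameQuadraticIsometryStable
import Literature.IUT.LogVolume.UnitLogWildDyadic
import Mathlib.NumberTheory.Padics.RingHoms
import HarnessLib

/-!
# Isometries FIX the maximal order of the two-slot packet at `ℚ₂(√−1)` and `ℚ₂(√3)` (wild, `d = e = 2`, `f = 1`)

Classical local algebra (nothing disputed; the [IUTchIV] locator records where the abc-iut cell uses it).
[IUTchIV] Prop. 1.1 p. 9 attaches to a tensor packet `V = ⊗_{ℚ_p} k_i` the lattice `R_I` and its normalisation
`(R_I)^∼`, the MAXIMAL `ℤ_p`-order of `V` (campaign-S `normalizedPacket`; `ψ((R_I)^∼) = Π_j 𝒪_{L_j}` for the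
field-factor decomposition `ψ = dEquiv`, Prop. 1.4 (i) p. 13).  The sibling files exhibit, at `p = 2`, `ℚ₂`-linear
factor ISOMETRIES that MOVE `(R_I)^∼` for `ℚ₂(√2)` (`WildQuadraticIsometryMover`), for every `K ∋ √−1` whose residue
field is not `𝔽₂` or which is unramified over `ℚ₂(√−1)` (`WildGaussianIsometryMover`), for every `K ⊇ ℚ₂(ζ₁₂)`
(`WildDyadicCyclotomicIsometryMover`), and `TameQuadraticIsometryStable` proves stability at `ℚ_p(√p)`, `p` ODD.

THIS FILE is a POSITIVE statement at a WILDLY ramified dyadic place.  Let `K` be an ultrametric normed field over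
`ℚ₂` with `[K : ℚ₂] = 2` containing `π` with `π² = c ∈ ℚ₂`, `‖c‖ = 1`, `‖1 + c‖ ≤ ¼` (i.e. `c ≡ 3 (mod 4)`; up to
isomorphism `K = ℚ₂(√−1)` or `K = ℚ₂(√3)`: ramification index `e = 2`, residue degree `f = 1`, `1 − π` a uniformiser,
`‖1 − π‖ = 2^{−1/2}`, different `(1 − π)²` — the dyadic quadratic fields whose different exponent EQUALS `e`).  Then for
EVERY pair `f₀, f₁` of `ℚ₂`-linear isometries of `K`, `(f₀ ⊗ f₁)((R_I)^∼) = (R_I)^∼` in `V = K ⊗_{ℚ₂} K`: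

* `norm_combo` — `‖u·1 + v·π‖ = max(‖u + v‖, ‖v‖·‖1 − π‖)` (`u, v ∈ ℚ₂`; write `u + vπ = (u+v) − v(1 − π)` and use
  that `2^ℤ` and `2^{ℤ+1/2}` never tie); `exists_basis` — the basis `(1, π)`;
* `norm_sub_pi_le_of_norm_sub_one` — RIGIDITY OF ISOMETRIES: if `w = s + tπ` has `‖w − 1‖ = ‖π − 1‖` then
  `‖w − π‖ ≤ ½` (value group + residue field `𝔽₂`: `t ≡ 1 (mod 2)`, `s + t ≡ 1 (mod 2)`); hence for an isometry `σ`
  with `α = σ(1)`: `σ(π) = α·(π + δ)` with `‖δ‖ ≤ ½`;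
* `repr_mem_normalizedPacket` / `norm_le_of_repr_mem` — `1 ⊗ l₀ + π ⊗ l₁ ∈ (R_I)^∼ ⟺ ‖l₀ ± π l₁‖ ≤ 1` (one field
  factor of each sign), whence `‖l₁‖ ≤ 2`;
* `congr_mem_of_isometry_left` — `(σ ⊗ 1)(1 ⊗ l₀ + π ⊗ l₁) = ι₀(α)·(z + δ ⊗ l₁)` and `δ ⊗ l₁ ∈ (R_I)^∼`
  (`‖δ‖·‖l₁‖ ≤ ½·2 = 1` in every factor): the slot-`0` isometry preserves `(R_I)^∼`; the slot swap
  `reindex (swap 0 1)` preserves `(R_I)^∼` (`reindex_swap_mem`) and conjugates `1 ⊗ τ` to `τ ⊗ 1`;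
* **`congr_mem_normalizedPacket_of_isometry`**, **`congr_image_normalizedPacket_eq_of_isometry`**,
  **`not_exists_isometry_mover`** — NO pair (factorwise isometries `f`, `z ∈ (R_I)^∼`) with `(⊗ f_i)(z) ∉ (R_I)^∼`
  exists: the negation, at these two WILD packets, of the exhibit shape `hmove` of the abc-iut cell's Y-29b reduction
  `Joshi/TestRealPinsMaxOrderMover`; specialisations `…_of_sq_eq_neg_one` (`ℚ₂(√−1)`), `…_of_sq_eq_three` (`ℚ₂(√3)`);
* **`exists_dyadicDiffTwo_isometry_stable`** — NON-VACUITY inside `ℚ̄₂` for every such `c` (e.g. `c = −1`, `c = 3`).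

Use (abc-iut cell, R-J row Y-29b «sign by place type», dyadic wording): at `p = 2` the invariants `(e_v, d_v)` do NOT
decide stability of `(R_I)^∼` under factor isometries — `ℚ₂(√−1)` (`e = 2`, different `(2)`) is STABLE for two slots
while `ℚ₂(ζ₁₂)` (same `e`, same different) is MOVED (`WildDyadicCyclotomicIsometryMover`); the residual dyadic class
«`d = e` and `f = 1`» of the trace-kernel-shear criterion is, among quadratic fields, exactly `{ℚ₂(√−1), ℚ₂(√3)}`, and
there every isometry pair fixes `(R_I)^∼`.  CONTAINERS only; no side is taken on [IUTchIII] Cor. 3.12.  Proof-only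
file (theorems, no definitions).
[cite: Mochizuki2012, IUTchIV Prop. 1.1 p. 9, Prop. 1.4 (i) p. 13] [cite: NeukirchANT1999, Ch. II (4.8)]
[cite: SerreLocalFields1979, Ch. II §1]
-/

noncomputable section

open Metric Set
open scoped TensorProduct

namespace Literature.IUT.LogVolume

namespace DyadicDiffTwo

/-! ## `ℚ₂`: value group `2^ℤ`, residue field `𝔽₂` -/

/-- The absolute value of a non-zero `2`-adic number is an integral power of `2`. [cite: SerreLocalFields1979, Ch. II §1] -/
theorem padic_exists_norm_eq_zpow {q : ℚ_[2]} (hq : q ≠ 0) : ∃ n : ℤ, ‖q‖ = 2 ^ n :=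
  ⟨-q.valuation, by rw [Padic.norm_eq_zpow_neg_valuation hq]; norm_num⟩

/-- Discreteness: `‖q‖ < 1 ⟹ ‖q‖ ≤ ½` in `ℚ₂`. [cite: SerreLocalFields1979, Ch. II §1] -/
theorem padic_norm_le_two_inv_of_lt_one {q : ℚ_[2]} (h : ‖q‖ < 1) : ‖q‖ ≤ 2⁻¹ := by
  rcases eq_or_ne q 0 with rfl | hq
  · rw [norm_zero]; norm_num
  obtain ⟨n, hn⟩ := padic_exists_norm_eq_zpow hq
  rw [hn] at h ⊢
  have hn0 : n ≤ -1 := by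
    by_contra hlt
    have h1 : (2 : ℝ) ^ (0 : ℤ) ≤ 2 ^ n := zpow_le_zpow_right₀ (by norm_num) (by omega)
    rw [zpow_zero] at h1
    exact absurd h (not_lt.mpr h1)
  calc (2 : ℝ) ^ n ≤ 2 ^ (-1 : ℤ) := zpow_le_zpow_right₀ (by norm_num) hn0
    _ = 2⁻¹ := zpow_neg_one 2

/-- Residue field `𝔽₂ = {0, 1}`: a unit `t` of `ℚ₂` has `‖t − 1‖ ≤ ½`. [cite: SerreLocalFields1979, Ch. II §1] -/
theorem padic_norm_sub_one_le {t : ℚ_[2]} (ht : ‖t‖ = 1) : ‖t - 1‖ ≤ 2⁻¹ := by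
  refine padic_norm_le_two_inv_of_lt_one ?_
  let x : ℤ_[2] := ⟨t, ht.le⟩
  have hker : x * (x - 1) ∈ RingHom.ker (PadicInt.toZMod : ℤ_[2] →+* ZMod 2) := by
    rw [RingHom.mem_ker, map_mul, map_sub, map_one]
    generalize PadicInt.toZMod x = r
    revert r
    decide
  rw [PadicInt.ker_toZMod, IsLocalRing.mem_maximalIdeal, PadicInt.mem_nonunits, norm_mul] at hker
  have hx1 : ‖x‖ = 1 := ht
  rw [hx1, one_mul] at hker
  have h2 : ‖((x - 1 : ℤ_[2]) : ℚ_[2])‖ < 1 := hker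
  rw [PadicInt.coe_sub, PadicInt.coe_one] at h2
  exact h2

/-- An integral and a half-integral power of `2` never tie: `2^n ≠ 2^m·N` when `N² = ½`. [cite: NeukirchANT1999, Ch. II (4.8)] -/
theorem zpow_ne_zpow_mul {N : ℝ} (hN : N ^ 2 = 2⁻¹) (n m : ℤ) : (2 : ℝ) ^ n ≠ 2 ^ m * N := by
  intro h
  have h2ne : (2 : ℝ) ≠ 0 := by norm_num
  have hπ : N = 2 ^ (n - m) := by
    rw [zpow_sub₀ h2ne, eq_div_iff (zpow_ne_zero m h2ne), mul_comm]
    exact h.symm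
  have h3 : (2 : ℝ) ^ ((n - m) * 2 + 1) = (2 : ℝ) ^ (0 : ℤ) := by
    rw [zpow_add₀ h2ne, zpow_mul, ← hπ, zpow_one, zpow_zero, zpow_two, ← sq, hN]
    norm_num
  have h4 := (zpow_right_inj₀ (by norm_num : (0 : ℝ) < 2) (by norm_num : (2 : ℝ) ≠ 1)).mp h3
  omega

/-! ## The field `K ∋ π`, `π² = c`, `‖c‖ = 1`, `‖1 + c‖ ≤ ¼` -/

variable {K : Type} [NontriviallyNormedField K] [NormedAlgebra ℚ_[2] K]
variable {π : K} {c : ℚ_[2]}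

/-- `‖π‖ = 1`. [cite: NeukirchANT1999, Ch. II (4.8)] -/
theorem norm_pi (hπ : π ^ 2 = algebraMap ℚ_[2] K c) (hc : ‖c‖ = 1) : ‖π‖ = 1 := by
  have h : ‖π‖ ^ 2 = 1 := by rw [← norm_pow, hπ, norm_algebraMap', hc]
  exact (pow_eq_one_iff_of_nonneg (norm_nonneg π) two_ne_zero).mp h

/-- `‖2π‖ = ½`. [cite: NeukirchANT1999, Ch. II (4.8)] -/
theorem norm_two_mul_pi (hπ : π ^ 2 = algebraMap ℚ_[2] K c) (hc : ‖c‖ = 1) : ‖(2 : K) * π‖ = 2⁻¹ := by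
  rw [norm_mul, WildDyadic.norm_two, norm_pi hπ hc, mul_one]

/-- **`‖1 − π‖² = ½`** (`(1 − π)² = (1 + c) − 2π`, `‖1 + c‖ ≤ ¼ < ½ = ‖2π‖`): `1 − π` is a uniformiser, `K/ℚ₂` is
(wildly) ramified. [cite: NeukirchANT1999, Ch. II (4.8)] -/
theorem norm_one_sub_pi_sq [IsUltrametricDist K] (hπ : π ^ 2 = algebraMap ℚ_[2] K c) (hc : ‖c‖ = 1)
    (hc1 : ‖1 + c‖ ≤ 4⁻¹) : ‖1 - π‖ ^ 2 = 2⁻¹ := by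
  have hexp : (1 - π) ^ 2 = algebraMap ℚ_[2] K (1 + c) + -((2 : K) * π) := by rw [map_add, map_one, ← hπ]; ring
  have hlt : ‖algebraMap ℚ_[2] K (1 + c)‖ < ‖-((2 : K) * π)‖ := by
    rw [norm_algebraMap', norm_neg, norm_two_mul_pi hπ hc]
    exact hc1.trans_lt (by norm_num)
  rw [← norm_pow, hexp, IsUltrametricDist.norm_add_eq_max_of_norm_ne_norm hlt.ne, max_eq_right hlt.le, norm_neg,
    norm_two_mul_pi hπ hc]

/-- `½ < ‖1 − π‖`. [cite: NeukirchANT1999, Ch. II (4.8)] -/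
theorem two_inv_lt_norm_one_sub_pi [IsUltrametricDist K] (hπ : π ^ 2 = algebraMap ℚ_[2] K c) (hc : ‖c‖ = 1)
    (hc1 : ‖1 + c‖ ≤ 4⁻¹) : (2 : ℝ)⁻¹ < ‖1 - π‖ := by
  have h := norm_one_sub_pi_sq hπ hc hc1
  nlinarith [norm_nonneg (1 - π)]

/-- `‖1 − π‖ < 1`. [cite: NeukirchANT1999, Ch. II (4.8)] -/
theorem norm_one_sub_pi_lt_one [IsUltrametricDist K] (hπ : π ^ 2 = algebraMap ℚ_[2] K c) (hc : ‖c‖ = 1)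
    (hc1 : ‖1 + c‖ ≤ 4⁻¹) : ‖1 - π‖ < 1 := by
  have h := norm_one_sub_pi_sq hπ hc hc1
  nlinarith [norm_nonneg (1 - π)]

/-- **`‖u·1 + v·π‖ = max(‖u + v‖, ‖v‖·‖1 − π‖)`** for `u, v ∈ ℚ₂` (`u·1 + v·π = (u + v)·1 − v·(1 − π)`, and the two
summands have absolute values in `2^ℤ ∪ {0}` resp. `2^{ℤ + 1/2} ∪ {0}`). [cite: NeukirchANT1999, Ch. II (4.8)] -/
theorem norm_combo [IsUltrametricDist K] (hπ : π ^ 2 = algebraMap ℚ_[2] K c) (hc : ‖c‖ = 1)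
    (hc1 : ‖1 + c‖ ≤ 4⁻¹) (u v : ℚ_[2]) : ‖u • (1 : K) + v • π‖ = max ‖u + v‖ (‖v‖ * ‖1 - π‖) := by
  have hexp : u • (1 : K) + v • π = (u + v) • (1 : K) + (-v) • (1 - π) := by module
  have hn1 : ‖(u + v) • (1 : K)‖ = ‖u + v‖ := TameQuadratic.norm_smul_one (u + v)
  have hn2 : ‖(-v) • (1 - π)‖ = ‖v‖ * ‖1 - π‖ := by rw [norm_smul, norm_neg]
  rw [hexp, WildCubic.norm_add_eq_max_of _ _ ?_, hn1, hn2]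
  by_cases huv : u + v = 0
  · exact Or.inl (by rw [huv, zero_smul])
  by_cases hv : v = 0
  · exact Or.inr (Or.inl (by rw [hv, neg_zero, zero_smul]))
  refine Or.inr (Or.inr ?_)
  obtain ⟨n, hn⟩ := padic_exists_norm_eq_zpow huv
  obtain ⟨m, hm⟩ := padic_exists_norm_eq_zpow hv
  rw [hn1, hn2, hn, hm]
  exact zpow_ne_zpow_mul (norm_one_sub_pi_sq hπ hc hc1) n m

/-- `(1, π)` is linearly independent over `ℚ₂`. [cite: NeukirchANT1999, Ch. II (4.8)] -/
theorem linearIndependent_one_pi [IsUltrametricDist K] (hπ : π ^ 2 = algebraMap ℚ_[2] K c) (hc : ‖c‖ = 1)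
    (hc1 : ‖1 + c‖ ≤ 4⁻¹) : LinearIndependent ℚ_[2] ![(1 : K), π] := by
  refine LinearIndependent.pair_iff.mpr fun s t hst => ?_
  have h : max ‖s + t‖ (‖t‖ * ‖1 - π‖) = 0 := by rw [← norm_combo hπ hc hc1, hst, norm_zero]
  have ht : ‖t‖ * ‖1 - π‖ = 0 := le_antisymm ((le_max_right _ _).trans_eq h) (by positivity)
  have ht0 : t = 0 := by
    rcases mul_eq_zero.mp ht with ht | ht
    · exact norm_eq_zero.mp ht
    · exact absurd ht ((by norm_num : (0 : ℝ) < 2⁻¹).trans (two_inv_lt_norm_one_sub_pi hπ hc hc1)).ne'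
  have hs : ‖s + t‖ = 0 := le_antisymm ((le_max_left _ _).trans_eq h) (norm_nonneg _)
  rw [ht0, add_zero] at hs
  exact ⟨norm_eq_zero.mp hs, ht0⟩

/-- A `ℚ₂`-basis `(1, π)` of `K` when `[K : ℚ₂] = 2`. [cite: NeukirchANT1999, Ch. II (4.8)] -/
theorem exists_basis [IsUltrametricDist K] (hK : Module.finrank ℚ_[2] K = 2) (hπ : π ^ 2 = algebraMap ℚ_[2] K c)
    (hc : ‖c‖ = 1) (hc1 : ‖1 + c‖ ≤ 4⁻¹) : ∃ B : Module.Basis (Fin 2) ℚ_[2] K, B 0 = 1 ∧ B 1 = π := by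
  have hli := linearIndependent_one_pi hπ hc hc1
  let B := basisOfLinearIndependentOfCardEqFinrank hli (by rw [hK, Fintype.card_fin])
  have hB : ⇑B = ![(1 : K), π] := coe_basisOfLinearIndependentOfCardEqFinrank _ _
  exact ⟨B, by rw [hB]; rfl, by rw [hB]; rfl⟩

/-- **RIGIDITY OF ISOMETRIES.**  If `w = s·1 + t·π` (`s, t ∈ ℚ₂`) satisfies `‖w − 1‖ = ‖π − 1‖`, then `‖w − π‖ ≤ ½`:
from `max(‖s − 1 + t‖, ‖t‖·2^{−1/2}) = 2^{−1/2}` one reads `‖t‖ = 1` (the first entry lies in `2^ℤ ∪ {0}`) and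
`‖s + t − 1‖ ≤ ½`; then `t ≡ 1 (mod 2)`, so `‖w − π‖ = max(‖s + t − 1‖, ‖t − 1‖·2^{−1/2}) ≤ ½`.  (Applied to
`w = σ(1)⁻¹·σ(π)` for an isometry `σ`.) [cite: NeukirchANT1999, Ch. II (4.8)] [cite: SerreLocalFields1979, Ch. II §1] -/
theorem norm_sub_pi_le_of_norm_sub_one [IsUltrametricDist K] (hπ : π ^ 2 = algebraMap ℚ_[2] K c) (hc : ‖c‖ = 1)
    (hc1 : ‖1 + c‖ ≤ 4⁻¹) (s t : ℚ_[2]) (h1 : ‖(s • (1 : K) + t • π) - 1‖ = ‖π - 1‖) :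
    ‖(s • (1 : K) + t • π) - π‖ ≤ 2⁻¹ := by
  have hN := norm_one_sub_pi_sq hπ hc hc1
  have hN1 := norm_one_sub_pi_lt_one hπ hc hc1
  have hN0 : 0 < ‖1 - π‖ := (by norm_num : (0 : ℝ) < 2⁻¹).trans (two_inv_lt_norm_one_sub_pi hπ hc hc1)
  have e1 : s • (1 : K) + t • π - 1 = (s - 1) • (1 : K) + t • π := by module
  have e2 : s • (1 : K) + t • π - π = s • (1 : K) + (t - 1) • π := by module
  rw [e1, norm_combo hπ hc hc1, norm_sub_rev π 1] at h1
  have ht1 : ‖t‖ ≤ 1 := by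
    have h : ‖t‖ * ‖1 - π‖ ≤ 1 * ‖1 - π‖ := by rw [one_mul]; exact (le_max_right _ _).trans_eq h1
    exact le_of_mul_le_mul_right h hN0
  have hst : ‖s - 1 + t‖ ≤ 2⁻¹ := padic_norm_le_two_inv_of_lt_one (((le_max_left _ _).trans_eq h1).trans_lt hN1)
  have ht : ‖t‖ = 1 := by
    by_contra hne
    have hlt : ‖t‖ * ‖1 - π‖ < ‖1 - π‖ := mul_lt_of_lt_one_left hN0 (lt_of_le_of_ne ht1 hne)
    have hmax : ‖s - 1 + t‖ = ‖1 - π‖ := by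
      rcases max_choice ‖s - 1 + t‖ (‖t‖ * ‖1 - π‖) with h | h
      · rw [← h, h1]
      · rw [h] at h1; exact absurd h1 hlt.ne
    rcases eq_or_ne (s - 1 + t) 0 with h0 | h0
    · rw [h0, norm_zero] at hmax; exact hN0.ne hmax
    · obtain ⟨n, hn⟩ := padic_exists_norm_eq_zpow h0
      refine zpow_ne_zpow_mul hN n 0 ?_
      rw [zpow_zero, one_mul, ← hn, hmax]
  have ht' : ‖t - 1‖ ≤ 2⁻¹ := padic_norm_sub_one_le ht
  rw [e2, norm_combo hπ hc hc1]
  refine max_le ?_ ?_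
  · rw [show s + (t - 1) = s - 1 + t by ring]; exact hst
  · calc ‖t - 1‖ * ‖1 - π‖ ≤ 2⁻¹ * 1 := mul_le_mul ht' hN1.le hN0.le (by norm_num)
      _ = 2⁻¹ := mul_one _

/-! ## The field factors of `K ⊗_{ℚ₂} K` and the maximal order -/

section Factors

variable [IsUltrametricDist K] [ProperSpace K]

omit [IsUltrametricDist K] in
/-- In every field factor `L_j` both images of `π` square to `c`. [cite: Mochizuki2012, IUTchIV Prop. 1.4 (i) p. 13] -/
theorem dEquiv_iota_pi_sq (hπ : π ^ 2 = algebraMap ℚ_[2] K c) (s : Fin 2) (j : DIdx 2 (fun _ : Fin 2 => K)) :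
    dEquiv 2 (fun _ : Fin 2 => K) (iota 2 (fun _ : Fin 2 => K) s π) j ^ 2 =
      algebraMap ℚ_[2] (DSum 2 (fun _ : Fin 2 => K)) c j := by
  rw [← Pi.pow_apply, ← map_pow, ← map_pow, hπ, AlgHom.commutes, AlgEquiv.commutes]

omit [IsUltrametricDist K] in
/-- **The two images of `π` in a field factor agree up to sign.** [cite: Mochizuki2012, IUTchIV Prop. 1.4 (i) p. 13] -/
theorem dEquiv_iota_pi_eq_or (hπ : π ^ 2 = algebraMap ℚ_[2] K c) (j : DIdx 2 (fun _ : Fin 2 => K)) :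
    dEquiv 2 (fun _ : Fin 2 => K) (iota 2 (fun _ : Fin 2 => K) 0 π) j =
        dEquiv 2 (fun _ : Fin 2 => K) (iota 2 (fun _ : Fin 2 => K) 1 π) j ∨
      dEquiv 2 (fun _ : Fin 2 => K) (iota 2 (fun _ : Fin 2 => K) 0 π) j =
        -dEquiv 2 (fun _ : Fin 2 => K) (iota 2 (fun _ : Fin 2 => K) 1 π) j :=
  sq_eq_sq_iff_eq_or_eq_neg.mp (by rw [dEquiv_iota_pi_sq hπ, dEquiv_iota_pi_sq hπ])

/-- Some field factor sees the two images of `π` with the SAME sign (else `π ⊗ 1 = −1 ⊗ π`) …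
[cite: Mochizuki2012, IUTchIV Prop. 1.4 (i) p. 13] -/
theorem exists_factor_eq (hK : Module.finrank ℚ_[2] K = 2) (hπ : π ^ 2 = algebraMap ℚ_[2] K c) (hc : ‖c‖ = 1)
    (hc1 : ‖1 + c‖ ≤ 4⁻¹) :
    ∃ j : DIdx 2 (fun _ : Fin 2 => K),
      dEquiv 2 (fun _ : Fin 2 => K) (iota 2 (fun _ : Fin 2 => K) 0 π) j =
        dEquiv 2 (fun _ : Fin 2 => K) (iota 2 (fun _ : Fin 2 => K) 1 π) j := by
  obtain ⟨B, hB0, hB1⟩ := exists_basis hK hπ hc hc1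
  by_contra h
  apply TameQuadratic.iota_pi_ne_smul B hB0 hB1 (-1)
  apply (dEquiv 2 (fun _ : Fin 2 => K)).injective
  rw [map_smul, neg_one_smul]
  funext j
  rw [Pi.neg_apply]
  exact (dEquiv_iota_pi_eq_or hπ j).resolve_left fun hj => h ⟨j, hj⟩

/-- … and some field factor sees them with OPPOSITE signs (else `π ⊗ 1 = 1 ⊗ π`).
[cite: Mochizuki2012, IUTchIV Prop. 1.4 (i) p. 13] -/
theorem exists_factor_eq_neg (hK : Module.finrank ℚ_[2] K = 2) (hπ : π ^ 2 = algebraMap ℚ_[2] K c) (hc : ‖c‖ = 1)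
    (hc1 : ‖1 + c‖ ≤ 4⁻¹) :
    ∃ j : DIdx 2 (fun _ : Fin 2 => K),
      dEquiv 2 (fun _ : Fin 2 => K) (iota 2 (fun _ : Fin 2 => K) 0 π) j =
        -dEquiv 2 (fun _ : Fin 2 => K) (iota 2 (fun _ : Fin 2 => K) 1 π) j := by
  obtain ⟨B, hB0, hB1⟩ := exists_basis hK hπ hc hc1
  by_contra h
  apply TameQuadratic.iota_pi_ne_smul B hB0 hB1 1
  apply (dEquiv 2 (fun _ : Fin 2 => K)).injective
  rw [one_smul]
  funext j
  exact (dEquiv_iota_pi_eq_or hπ j).resolve_right fun hj => h ⟨j, hj⟩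

/-- **`1 ⊗ l₀ + π ⊗ l₁ ∈ (R_I)^∼` whenever `‖l₀ + π l₁‖ ≤ 1` and `‖l₀ − π l₁‖ ≤ 1`**: every factor sees
`ι_j(l₀ ± π·l₁)`. [cite: Mochizuki2012, IUTchIV Prop. 1.1 p. 9] -/
theorem repr_mem_normalizedPacket (hπ : π ^ 2 = algebraMap ℚ_[2] K c) {l₀ l₁ : K} (hplus : ‖l₀ + π * l₁‖ ≤ 1)
    (hminus : ‖l₀ - π * l₁‖ ≤ 1) :
    purePacket 2 (fun _ : Fin 2 => K) ![1, l₀] + purePacket 2 (fun _ : Fin 2 => K) ![π, l₁] ∈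
      normalizedPacket 2 (fun _ : Fin 2 => K) := by
  refine TameQuadratic.mem_normalizedPacket_of_norm_dEquiv_le fun j => ?_
  rcases dEquiv_iota_pi_eq_or hπ j with h | h
  · rw [TameQuadratic.dEquiv_repr_of_eq h, norm_dEquiv_iota]; exact hplus
  · rw [TameQuadratic.dEquiv_repr_of_eq_neg h, norm_dEquiv_iota]; exact hminus

/-- **Conversely `1 ⊗ l₀ + π ⊗ l₁ ∈ (R_I)^∼` forces `‖l₀ ± π l₁‖ ≤ 1`** (one factor of each kind).
[cite: Mochizuki2012, IUTchIV Prop. 1.1 p. 9] -/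
theorem norm_le_of_repr_mem (hK : Module.finrank ℚ_[2] K = 2) (hπ : π ^ 2 = algebraMap ℚ_[2] K c) (hc : ‖c‖ = 1)
    (hc1 : ‖1 + c‖ ≤ 4⁻¹) {l₀ l₁ : K}
    (hz : purePacket 2 (fun _ : Fin 2 => K) ![1, l₀] + purePacket 2 (fun _ : Fin 2 => K) ![π, l₁] ∈
      normalizedPacket 2 (fun _ : Fin 2 => K)) :
    ‖l₀ + π * l₁‖ ≤ 1 ∧ ‖l₀ - π * l₁‖ ≤ 1 := by
  obtain ⟨jp, hjp⟩ := exists_factor_eq hK hπ hc hc1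
  obtain ⟨jm, hjm⟩ := exists_factor_eq_neg hK hπ hc hc1
  constructor
  · have h := norm_dEquiv_le_one_of_mem_normalizedPacket 2 (fun _ : Fin 2 => K) hz jp
    rwa [TameQuadratic.dEquiv_repr_of_eq hjp, norm_dEquiv_iota] at h
  · have h := norm_dEquiv_le_one_of_mem_normalizedPacket 2 (fun _ : Fin 2 => K) hz jm
    rwa [TameQuadratic.dEquiv_repr_of_eq_neg hjm, norm_dEquiv_iota] at h

omit [ProperSpace K] in
/-- `‖l₀ ± π l₁‖ ≤ 1 ⟹ ‖l₁‖ ≤ 2` (`2π l₁` is the difference; `‖2π‖ = ½`). [cite: NeukirchANT1999, Ch. II (4.8)] -/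
theorem norm_le_two_of_norm_le (hπ : π ^ 2 = algebraMap ℚ_[2] K c) (hc : ‖c‖ = 1) {l₀ l₁ : K}
    (hplus : ‖l₀ + π * l₁‖ ≤ 1) (hminus : ‖l₀ - π * l₁‖ ≤ 1) : ‖l₁‖ ≤ 2 := by
  have h : ‖(2 : K) * π * l₁‖ ≤ 1 := by
    rw [show (2 : K) * π * l₁ = (l₀ + π * l₁) + -(l₀ - π * l₁) by ring]
    exact (IsUltrametricDist.norm_add_le_max _ _).trans (max_le hplus (by rwa [norm_neg]))
  rw [norm_mul, norm_two_mul_pi hπ hc] at h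
  linarith

omit [IsUltrametricDist K] [ProperSpace K] in
/-- `ι₀(a)·(x ⊗ y) = (a x) ⊗ y`. [cite: Mochizuki2012, IUTchIV Prop. 1.1 p. 9] -/
theorem iota_mul_purePacket_pair (a x y : K) :
    iota 2 (fun _ : Fin 2 => K) 0 a * purePacket 2 (fun _ : Fin 2 => K) ![x, y] =
      purePacket 2 (fun _ : Fin 2 => K) ![a * x, y] := by
  rw [TameQuadratic.purePacket_pair_eq_iota_mul, TameQuadratic.purePacket_pair_eq_iota_mul, map_mul, mul_assoc]

/-- `ι₀(a) ∈ (R_I)^∼` for `‖a‖ ≤ 1`. [cite: Mochizuki2012, IUTchIV Prop. 1.4 (i) p. 13] -/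
theorem iota_mem_normalizedPacket {a : K} (ha : ‖a‖ ≤ 1) :
    iota 2 (fun _ : Fin 2 => K) 0 a ∈ normalizedPacket 2 (fun _ : Fin 2 => K) :=
  TameQuadratic.mem_normalizedPacket_of_norm_dEquiv_le fun j => by rw [norm_dEquiv_iota]; exact ha

/-- `x ⊗ y ∈ (R_I)^∼` whenever `‖x‖·‖y‖ ≤ 1` (every factor coordinate is `ι_j⁰(x)·ι_j¹(y)`).
[cite: Mochizuki2012, IUTchIV Prop. 1.4 (i) p. 13] -/
theorem purePacket_pair_mem_normalizedPacket {x y : K} (h : ‖x‖ * ‖y‖ ≤ 1) :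
    purePacket 2 (fun _ : Fin 2 => K) ![x, y] ∈ normalizedPacket 2 (fun _ : Fin 2 => K) :=
  TameQuadratic.mem_normalizedPacket_of_norm_dEquiv_le fun j => by
    rw [TameQuadratic.dEquiv_purePacket_pair, norm_mul, norm_dEquiv_iota, norm_dEquiv_iota]; exact h

/-- **THE SLOT-`0` ISOMETRY PRESERVES `(R_I)^∼`.**  For a `ℚ₂`-linear isometry `σ` of `K`, `α = σ(1)`,
`σ(π) = α(π + δ)` with `‖δ‖ ≤ ½` (`norm_sub_pi_le_of_norm_sub_one`), and for `z = 1 ⊗ l₀ + π ⊗ l₁ ∈ (R_I)^∼`: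
`(σ ⊗ 1)(z) = ι₀(α)·(z + δ ⊗ l₁)` with `ι₀(α), z, δ ⊗ l₁ ∈ (R_I)^∼` (`‖δ‖‖l₁‖ ≤ ½·2`).
[cite: Mochizuki2012, IUTchIV Prop. 1.1 p. 9] [cite: NeukirchANT1999, Ch. II (4.8)] -/
theorem congr_mem_of_isometry_left (hK : Module.finrank ℚ_[2] K = 2) (hπ : π ^ 2 = algebraMap ℚ_[2] K c)
    (hc : ‖c‖ = 1) (hc1 : ‖1 + c‖ ≤ 4⁻¹) (σ : K ≃ₗ[ℚ_[2]] K) (hσ : ∀ x, ‖σ x‖ = ‖x‖)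
    {z : PacketAlgebra 2 (fun _ : Fin 2 => K)} (hz : z ∈ normalizedPacket 2 (fun _ : Fin 2 => K)) :
    (PiTensorProduct.congr (![σ, LinearEquiv.refl ℚ_[2] K] : ∀ _ : Fin 2, K ≃ₗ[ℚ_[2]] K) :
        PacketAlgebra 2 (fun _ : Fin 2 => K) ≃ₗ[ℚ_[2]] PacketAlgebra 2 (fun _ : Fin 2 => K)) z ∈
      normalizedPacket 2 (fun _ : Fin 2 => K) := by
  obtain ⟨B, hB0, hB1⟩ := exists_basis hK hπ hc hc1
  obtain ⟨l₀, l₁, rfl⟩ := TameQuadratic.exists_repr B hB0 hB1 z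
  obtain ⟨hplus, hminus⟩ := norm_le_of_repr_mem hK hπ hc hc1 hz
  have hl₁ : ‖l₁‖ ≤ 2 := norm_le_two_of_norm_le hπ hc hplus hminus
  have hα1 : ‖σ 1‖ = 1 := by rw [hσ, norm_one]
  have hα0 : σ 1 ≠ 0 := fun h => by rw [h, norm_zero] at hα1; exact zero_ne_one hα1
  set w : K := (σ 1)⁻¹ * σ π with hw
  have hσπ : σ π = σ 1 * w := by rw [hw, ← mul_assoc, mul_inv_cancel₀ hα0, one_mul]
  have hw1 : ‖w - 1‖ = ‖π - 1‖ := by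
    have h : σ (π - 1) = σ 1 * (w - 1) := by rw [map_sub, hσπ, mul_sub, mul_one]
    have h' := hσ (π - 1)
    rwa [h, norm_mul, hα1, one_mul] at h'
  have hδ : ‖w - π‖ ≤ 2⁻¹ := by
    have h := norm_sub_pi_le_of_norm_sub_one hπ hc hc1 (B.repr w 0) (B.repr w 1)
      (by rw [TameQuadratic.combo_repr B hB0 hB1 w]; exact hw1)
    rwa [TameQuadratic.combo_repr B hB0 hB1 w] at h
  have hcongr : (PiTensorProduct.congr (![σ, LinearEquiv.refl ℚ_[2] K] : ∀ _ : Fin 2, K ≃ₗ[ℚ_[2]] K) :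
        PacketAlgebra 2 (fun _ : Fin 2 => K) ≃ₗ[ℚ_[2]] PacketAlgebra 2 (fun _ : Fin 2 => K))
        (purePacket 2 (fun _ : Fin 2 => K) ![1, l₀] + purePacket 2 (fun _ : Fin 2 => K) ![π, l₁]) =
      iota 2 (fun _ : Fin 2 => K) 0 (σ 1) *
        ((purePacket 2 (fun _ : Fin 2 => K) ![1, l₀] + purePacket 2 (fun _ : Fin 2 => K) ![π, l₁]) +
          purePacket 2 (fun _ : Fin 2 => K) ![w - π, l₁]) := by
    rw [map_add, TameQuadratic.congr_purePacket_pair, TameQuadratic.congr_purePacket_pair]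
    simp only [Matrix.cons_val_zero, Matrix.cons_val_one, LinearEquiv.refl_apply]
    rw [add_assoc, ← TameQuadratic.purePacket_pair_add_left, add_sub_cancel, mul_add, iota_mul_purePacket_pair,
      iota_mul_purePacket_pair, mul_one, hσπ]
  rw [hcongr]
  refine Subring.mul_mem _ (iota_mem_normalizedPacket hα1.le) (Subring.add_mem _ hz ?_)
  refine purePacket_pair_mem_normalizedPacket ?_
  calc ‖w - π‖ * ‖l₁‖ ≤ 2⁻¹ * 2 := mul_le_mul hδ hl₁ (norm_nonneg _) (by norm_num)
    _ = 1 := by norm_num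

/-! ## The slot swap -/

omit [IsUltrametricDist K] [ProperSpace K] in
/-- The slot swap `x ⊗ y ↦ y ⊗ x`. [cite: Mochizuki2012, IUTchIV Prop. 1.1 p. 9] -/
theorem reindex_swap_purePacket_pair (x y : K) :
    (PiTensorProduct.reindex ℚ_[2] (fun _ : Fin 2 => K) (Equiv.swap (0 : Fin 2) 1) :
        PacketAlgebra 2 (fun _ : Fin 2 => K) ≃ₗ[ℚ_[2]] PacketAlgebra 2 (fun _ : Fin 2 => K))
        (purePacket 2 (fun _ : Fin 2 => K) ![x, y]) = purePacket 2 (fun _ : Fin 2 => K) ![y, x] := by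
  rw [purePacket, purePacket, PiTensorProduct.reindex_tprod]
  congr 1
  funext i
  fin_cases i
  · simp [Equiv.swap_apply_left]
  · simp [Equiv.swap_apply_right]

omit [IsUltrametricDist K] [ProperSpace K] in
/-- The slot swap is an involution. [cite: Mochizuki2012, IUTchIV Prop. 1.1 p. 9] -/
theorem reindex_swap_reindex_swap (z : PacketAlgebra 2 (fun _ : Fin 2 => K)) :
    (PiTensorProduct.reindex ℚ_[2] (fun _ : Fin 2 => K) (Equiv.swap (0 : Fin 2) 1) :
        PacketAlgebra 2 (fun _ : Fin 2 => K) ≃ₗ[ℚ_[2]] PacketAlgebra 2 (fun _ : Fin 2 => K))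
      ((PiTensorProduct.reindex ℚ_[2] (fun _ : Fin 2 => K) (Equiv.swap (0 : Fin 2) 1) :
        PacketAlgebra 2 (fun _ : Fin 2 => K) ≃ₗ[ℚ_[2]] PacketAlgebra 2 (fun _ : Fin 2 => K)) z) = z := by
  induction z using PiTensorProduct.induction_on with
  | smul_tprod r f =>
    have hf : PiTensorProduct.tprod ℚ_[2] f = purePacket 2 (fun _ : Fin 2 => K) ![f 0, f 1] := by
      rw [purePacket]; congr 1; funext i; fin_cases i <;> rfl
    rw [hf, map_smul, map_smul, reindex_swap_purePacket_pair, reindex_swap_purePacket_pair]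
  | add x y hx hy => rw [map_add, map_add, hx, hy]

omit [IsUltrametricDist K] [ProperSpace K] in
/-- The slot swap conjugates `1 ⊗ τ` to `τ ⊗ 1`. [cite: Mochizuki2012, IUTchIV Prop. 1.1 p. 9] -/
theorem reindex_swap_congr_right (τ : K ≃ₗ[ℚ_[2]] K) (z : PacketAlgebra 2 (fun _ : Fin 2 => K)) :
    (PiTensorProduct.reindex ℚ_[2] (fun _ : Fin 2 => K) (Equiv.swap (0 : Fin 2) 1) :
        PacketAlgebra 2 (fun _ : Fin 2 => K) ≃ₗ[ℚ_[2]] PacketAlgebra 2 (fun _ : Fin 2 => K))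
      ((PiTensorProduct.congr (![LinearEquiv.refl ℚ_[2] K, τ] : ∀ _ : Fin 2, K ≃ₗ[ℚ_[2]] K) :
        PacketAlgebra 2 (fun _ : Fin 2 => K) ≃ₗ[ℚ_[2]] PacketAlgebra 2 (fun _ : Fin 2 => K)) z) =
      (PiTensorProduct.congr (![τ, LinearEquiv.refl ℚ_[2] K] : ∀ _ : Fin 2, K ≃ₗ[ℚ_[2]] K) :
        PacketAlgebra 2 (fun _ : Fin 2 => K) ≃ₗ[ℚ_[2]] PacketAlgebra 2 (fun _ : Fin 2 => K))
      ((PiTensorProduct.reindex ℚ_[2] (fun _ : Fin 2 => K) (Equiv.swap (0 : Fin 2) 1) :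
        PacketAlgebra 2 (fun _ : Fin 2 => K) ≃ₗ[ℚ_[2]] PacketAlgebra 2 (fun _ : Fin 2 => K)) z) := by
  induction z using PiTensorProduct.induction_on with
  | smul_tprod r f =>
    have hf : PiTensorProduct.tprod ℚ_[2] f = purePacket 2 (fun _ : Fin 2 => K) ![f 0, f 1] := by
      rw [purePacket]; congr 1; funext i; fin_cases i <;> rfl
    rw [hf, map_smul, map_smul, map_smul, map_smul, TameQuadratic.congr_purePacket_pair, reindex_swap_purePacket_pair,
      reindex_swap_purePacket_pair, TameQuadratic.congr_purePacket_pair]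
    simp only [Matrix.cons_val_zero, Matrix.cons_val_one, LinearEquiv.refl_apply]
  | add x y hx hy => rw [map_add, map_add, hx, hy, map_add, map_add]

/-- **The slot swap preserves `(R_I)^∼`**: `l₀ ⊗ 1 + l₁ ⊗ π` has factor coordinates `ι⁰_j(l₀ ± π l₁)`.
[cite: Mochizuki2012, IUTchIV Prop. 1.4 (i) p. 13] -/
theorem reindex_swap_mem (hK : Module.finrank ℚ_[2] K = 2) (hπ : π ^ 2 = algebraMap ℚ_[2] K c) (hc : ‖c‖ = 1)
    (hc1 : ‖1 + c‖ ≤ 4⁻¹) {z : PacketAlgebra 2 (fun _ : Fin 2 => K)} (hz : z ∈ normalizedPacket 2 (fun _ : Fin 2 => K)) :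
    (PiTensorProduct.reindex ℚ_[2] (fun _ : Fin 2 => K) (Equiv.swap (0 : Fin 2) 1) :
        PacketAlgebra 2 (fun _ : Fin 2 => K) ≃ₗ[ℚ_[2]] PacketAlgebra 2 (fun _ : Fin 2 => K)) z ∈
      normalizedPacket 2 (fun _ : Fin 2 => K) := by
  obtain ⟨B, hB0, hB1⟩ := exists_basis hK hπ hc hc1
  obtain ⟨l₀, l₁, rfl⟩ := TameQuadratic.exists_repr B hB0 hB1 z
  obtain ⟨hplus, hminus⟩ := norm_le_of_repr_mem hK hπ hc hc1 hz
  rw [map_add, reindex_swap_purePacket_pair, reindex_swap_purePacket_pair]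
  refine TameQuadratic.mem_normalizedPacket_of_norm_dEquiv_le fun j => ?_
  rw [map_add, Pi.add_apply, TameQuadratic.dEquiv_purePacket_pair, TameQuadratic.dEquiv_purePacket_pair, map_one,
    map_one, Pi.one_apply, mul_one]
  rcases dEquiv_iota_pi_eq_or hπ j with h | h
  · have e : dEquiv 2 (fun _ : Fin 2 => K) (iota 2 (fun _ : Fin 2 => K) 0 l₀) j +
          dEquiv 2 (fun _ : Fin 2 => K) (iota 2 (fun _ : Fin 2 => K) 0 l₁) j *
            dEquiv 2 (fun _ : Fin 2 => K) (iota 2 (fun _ : Fin 2 => K) 1 π) j =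
        dEquiv 2 (fun _ : Fin 2 => K) (iota 2 (fun _ : Fin 2 => K) 0 (l₀ + π * l₁)) j := by
      rw [← h, map_add, map_mul, map_add, map_mul, Pi.add_apply, Pi.mul_apply]; ring
    rw [e, norm_dEquiv_iota]; exact hplus
  · have h' : dEquiv 2 (fun _ : Fin 2 => K) (iota 2 (fun _ : Fin 2 => K) 1 π) j =
        -dEquiv 2 (fun _ : Fin 2 => K) (iota 2 (fun _ : Fin 2 => K) 0 π) j := by rw [h, neg_neg]
    have e : dEquiv 2 (fun _ : Fin 2 => K) (iota 2 (fun _ : Fin 2 => K) 0 l₀) j +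
          dEquiv 2 (fun _ : Fin 2 => K) (iota 2 (fun _ : Fin 2 => K) 0 l₁) j *
            dEquiv 2 (fun _ : Fin 2 => K) (iota 2 (fun _ : Fin 2 => K) 1 π) j =
        dEquiv 2 (fun _ : Fin 2 => K) (iota 2 (fun _ : Fin 2 => K) 0 (l₀ - π * l₁)) j := by
      rw [h', map_sub, map_mul, map_sub, map_mul, Pi.sub_apply, Pi.mul_apply]; ring
    rw [e, norm_dEquiv_iota]; exact hminus

/-! ## Every factorwise isometry fixes `(R_I)^∼` -/

omit [IsUltrametricDist K] [ProperSpace K] in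
/-- `f₀ ⊗ f₁ = (f₀ ⊗ 1) ∘ (1 ⊗ f₁)`. [cite: Mochizuki2012, IUTchIV Prop. 1.1 p. 9] -/
theorem congr_eq_congr_left_congr_right (f : ∀ _ : Fin 2, K ≃ₗ[ℚ_[2]] K) (z : PacketAlgebra 2 (fun _ : Fin 2 => K)) :
    (PiTensorProduct.congr f :
        PacketAlgebra 2 (fun _ : Fin 2 => K) ≃ₗ[ℚ_[2]] PacketAlgebra 2 (fun _ : Fin 2 => K)) z =
      (PiTensorProduct.congr (![f 0, LinearEquiv.refl ℚ_[2] K] : ∀ _ : Fin 2, K ≃ₗ[ℚ_[2]] K) :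
        PacketAlgebra 2 (fun _ : Fin 2 => K) ≃ₗ[ℚ_[2]] PacketAlgebra 2 (fun _ : Fin 2 => K))
      ((PiTensorProduct.congr (![LinearEquiv.refl ℚ_[2] K, f 1] : ∀ _ : Fin 2, K ≃ₗ[ℚ_[2]] K) :
        PacketAlgebra 2 (fun _ : Fin 2 => K) ≃ₗ[ℚ_[2]] PacketAlgebra 2 (fun _ : Fin 2 => K)) z) := by
  induction z using PiTensorProduct.induction_on with
  | smul_tprod r x =>
    have hx : PiTensorProduct.tprod ℚ_[2] x = purePacket 2 (fun _ : Fin 2 => K) ![x 0, x 1] := by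
      rw [purePacket]; congr 1; funext i; fin_cases i <;> rfl
    rw [hx, map_smul, map_smul, map_smul, TameQuadratic.congr_purePacket_pair, TameQuadratic.congr_purePacket_pair,
      TameQuadratic.congr_purePacket_pair]
    simp only [Matrix.cons_val_zero, Matrix.cons_val_one, LinearEquiv.refl_apply]
  | add x y hx hy => rw [map_add, hx, hy, map_add, map_add]

/-- **ISOMETRIES FIX THE MAXIMAL ORDER** at `K ∋ π`, `π² = c`, `‖c‖ = 1`, `‖1 + c‖ ≤ ¼`, `[K : ℚ₂] = 2`: for every
pair of `ℚ₂`-linear isometries `f₀, f₁` of `K` and every `z ∈ (R_I)^∼`, `(f₀ ⊗ f₁)(z) ∈ (R_I)^∼`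
(`f₀ ⊗ f₁ = (f₀ ⊗ 1) ∘ swap ∘ (f₁ ⊗ 1) ∘ swap`). [cite: Mochizuki2012, IUTchIV Prop. 1.1 p. 9] [cite: NeukirchANT1999, Ch. II (4.8)] -/
theorem congr_mem_normalizedPacket_of_isometry (hK : Module.finrank ℚ_[2] K = 2) (hπ : π ^ 2 = algebraMap ℚ_[2] K c)
    (hc : ‖c‖ = 1) (hc1 : ‖1 + c‖ ≤ 4⁻¹) (f : ∀ _ : Fin 2, K ≃ₗ[ℚ_[2]] K) (hf : ∀ i x, ‖f i x‖ = ‖x‖)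
    {z : PacketAlgebra 2 (fun _ : Fin 2 => K)} (hz : z ∈ normalizedPacket 2 (fun _ : Fin 2 => K)) :
    (PiTensorProduct.congr f :
        PacketAlgebra 2 (fun _ : Fin 2 => K) ≃ₗ[ℚ_[2]] PacketAlgebra 2 (fun _ : Fin 2 => K)) z ∈
      normalizedPacket 2 (fun _ : Fin 2 => K) := by
  rw [congr_eq_congr_left_congr_right]
  refine congr_mem_of_isometry_left hK hπ hc hc1 (f 0) (hf 0) ?_
  have h : (PiTensorProduct.congr (![LinearEquiv.refl ℚ_[2] K, f 1] : ∀ _ : Fin 2, K ≃ₗ[ℚ_[2]] K) :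
        PacketAlgebra 2 (fun _ : Fin 2 => K) ≃ₗ[ℚ_[2]] PacketAlgebra 2 (fun _ : Fin 2 => K)) z =
      (PiTensorProduct.reindex ℚ_[2] (fun _ : Fin 2 => K) (Equiv.swap (0 : Fin 2) 1) :
        PacketAlgebra 2 (fun _ : Fin 2 => K) ≃ₗ[ℚ_[2]] PacketAlgebra 2 (fun _ : Fin 2 => K))
      ((PiTensorProduct.congr (![f 1, LinearEquiv.refl ℚ_[2] K] : ∀ _ : Fin 2, K ≃ₗ[ℚ_[2]] K) :
          PacketAlgebra 2 (fun _ : Fin 2 => K) ≃ₗ[ℚ_[2]] PacketAlgebra 2 (fun _ : Fin 2 => K))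
        ((PiTensorProduct.reindex ℚ_[2] (fun _ : Fin 2 => K) (Equiv.swap (0 : Fin 2) 1) :
          PacketAlgebra 2 (fun _ : Fin 2 => K) ≃ₗ[ℚ_[2]] PacketAlgebra 2 (fun _ : Fin 2 => K)) z)) := by
    rw [← reindex_swap_congr_right, reindex_swap_reindex_swap]
  rw [h]
  exact reindex_swap_mem hK hπ hc hc1
    (congr_mem_of_isometry_left hK hπ hc hc1 (f 1) (hf 1) (reindex_swap_mem hK hπ hc hc1 hz))

/-- **… and ONTO itself: `(f₀ ⊗ f₁)((R_I)^∼) = (R_I)^∼`** (apply the previous statement to `f` and to `f⁻¹`).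
[cite: Mochizuki2012, IUTchIV Prop. 1.1 p. 9] [cite: NeukirchANT1999, Ch. II (4.8)] -/
theorem congr_image_normalizedPacket_eq_of_isometry (hK : Module.finrank ℚ_[2] K = 2)
    (hπ : π ^ 2 = algebraMap ℚ_[2] K c) (hc : ‖c‖ = 1) (hc1 : ‖1 + c‖ ≤ 4⁻¹) (f : ∀ _ : Fin 2, K ≃ₗ[ℚ_[2]] K)
    (hf : ∀ i x, ‖f i x‖ = ‖x‖) :
    (PiTensorProduct.congr f :
        PacketAlgebra 2 (fun _ : Fin 2 => K) ≃ₗ[ℚ_[2]] PacketAlgebra 2 (fun _ : Fin 2 => K)) ''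
        (normalizedPacket 2 (fun _ : Fin 2 => K) : Set (PacketAlgebra 2 (fun _ : Fin 2 => K))) =
      (normalizedPacket 2 (fun _ : Fin 2 => K) : Set (PacketAlgebra 2 (fun _ : Fin 2 => K))) := by
  have hf' : ∀ i x, ‖(f i).symm x‖ = ‖x‖ := fun i x => by
    conv_rhs => rw [← (f i).apply_symm_apply x]
    rw [hf]
  apply Set.Subset.antisymm
  · rintro _ ⟨z, hz, rfl⟩
    exact congr_mem_normalizedPacket_of_isometry hK hπ hc hc1 f hf hz
  · intro w hw
    exact ⟨_, congr_mem_normalizedPacket_of_isometry hK hπ hc hc1 (fun i => (f i).symm) hf' hw,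
      TameQuadratic.congr_congr_symm_apply f w⟩

/-- **NO ISOMETRIC MAXIMAL-ORDER MOVER EXISTS** at `K ∋ π`, `π² = c`, `‖c‖ = 1`, `‖1 + c‖ ≤ ¼`, `[K : ℚ₂] = 2`: no pair
(factorwise `ℚ₂`-linear isometries `f`, `z ∈ (R_I)^∼`) with `(⊗ f_i)(z) ∉ (R_I)^∼` — contrast the dyadic movers of
`WildQuadraticIsometryMover` (`√2`), `WildGaussianIsometryMover`, `WildDyadicCyclotomicIsometryMover` (`ζ₁₂`).
[cite: Mochizuki2012, IUTchIV Prop. 1.1 p. 9] -/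
theorem not_exists_isometry_mover (hK : Module.finrank ℚ_[2] K = 2) (hπ : π ^ 2 = algebraMap ℚ_[2] K c)
    (hc : ‖c‖ = 1) (hc1 : ‖1 + c‖ ≤ 4⁻¹) :
    ¬ ∃ (f : ∀ _ : Fin 2, K ≃ₗ[ℚ_[2]] K) (_ : ∀ i x, ‖f i x‖ = ‖x‖) (z : PacketAlgebra 2 (fun _ : Fin 2 => K)),
      z ∈ (normalizedPacket 2 (fun _ : Fin 2 => K) : Set (PacketAlgebra 2 (fun _ : Fin 2 => K))) ∧
        (PiTensorProduct.congr f :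
            PacketAlgebra 2 (fun _ : Fin 2 => K) ≃ₗ[ℚ_[2]] PacketAlgebra 2 (fun _ : Fin 2 => K)) z ∉
          (normalizedPacket 2 (fun _ : Fin 2 => K) : Set (PacketAlgebra 2 (fun _ : Fin 2 => K))) := by
  rintro ⟨f, hf, z, hz, hnot⟩
  exact hnot (congr_mem_normalizedPacket_of_isometry hK hπ hc hc1 f hf hz)

/-- **`ℚ₂(√−1)`**: `[K : ℚ₂] = 2`, `i ∈ K`, `i² = −1` ⟹ every factorwise isometry maps `(R_I)^∼` onto itself — while
`WildGaussianIsometryMover.exists_isometry_maxOrder_mover` MOVES it as soon as `K ∋ i` has residue field `≠ 𝔽₂` or is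
unramified over `ℚ₂(i)`. [cite: Mochizuki2012, IUTchIV Prop. 1.1 p. 9] [cite: NeukirchANT1999, Ch. II (4.8)] -/
theorem congr_image_normalizedPacket_eq_of_isometry_of_sq_eq_neg_one (hK : Module.finrank ℚ_[2] K = 2) {i : K}
    (hi : i ^ 2 = -1) (f : ∀ _ : Fin 2, K ≃ₗ[ℚ_[2]] K) (hf : ∀ i x, ‖f i x‖ = ‖x‖) :
    (PiTensorProduct.congr f :
        PacketAlgebra 2 (fun _ : Fin 2 => K) ≃ₗ[ℚ_[2]] PacketAlgebra 2 (fun _ : Fin 2 => K)) ''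
        (normalizedPacket 2 (fun _ : Fin 2 => K) : Set (PacketAlgebra 2 (fun _ : Fin 2 => K))) =
      (normalizedPacket 2 (fun _ : Fin 2 => K) : Set (PacketAlgebra 2 (fun _ : Fin 2 => K))) :=
  congr_image_normalizedPacket_eq_of_isometry hK (c := -1) (by rw [hi, map_neg, map_one]) (by rw [norm_neg, norm_one])
    (by norm_num) f hf

/-- **`ℚ₂(√3)`**: `[K : ℚ₂] = 2`, `π ∈ K`, `π² = 3` ⟹ every factorwise isometry maps `(R_I)^∼` onto itself.
[cite: Mochizuki2012, IUTchIV Prop. 1.1 p. 9] [cite: NeukirchANT1999, Ch. II (4.8)] -/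
theorem congr_image_normalizedPacket_eq_of_isometry_of_sq_eq_three (hK : Module.finrank ℚ_[2] K = 2)
    (h3 : π ^ 2 = 3) (f : ∀ _ : Fin 2, K ≃ₗ[ℚ_[2]] K) (hf : ∀ i x, ‖f i x‖ = ‖x‖) :
    (PiTensorProduct.congr f :
        PacketAlgebra 2 (fun _ : Fin 2 => K) ≃ₗ[ℚ_[2]] PacketAlgebra 2 (fun _ : Fin 2 => K)) ''
        (normalizedPacket 2 (fun _ : Fin 2 => K) : Set (PacketAlgebra 2 (fun _ : Fin 2 => K))) =
      (normalizedPacket 2 (fun _ : Fin 2 => K) : Set (PacketAlgebra 2 (fun _ : Fin 2 => K))) := by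
  have h3' : ‖(3 : ℚ_[2])‖ = 1 := by
    have h := (Padic.norm_natCast_eq_one_iff (p := 2) (n := 3)).mpr (by decide)
    simpa using h
  have h4 : ‖(1 : ℚ_[2]) + 3‖ ≤ 4⁻¹ := by
    rw [show (1 : ℚ_[2]) + 3 = 2 * 2 by norm_num, norm_mul, WildDyadic.norm_two]
    norm_num
  exact congr_image_normalizedPacket_eq_of_isometry hK (c := 3) (by rw [h3, map_ofNat]) h3' h4 f hf

end Factors

end DyadicDiffTwo

/-! ## Non-vacuity: `ℚ₂(√c) ⊆ ℚ̄₂` -/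

open Polynomial IntermediateField in
/-- **The quadratic subfield `ℚ₂(√c) ⊆ ℚ̄₂`** for `‖c‖ = 1`, `‖1 + c‖ ≤ ¼`: `[ℚ₂(√c) : ℚ₂] = 2` (`c` is not a square in
`ℚ₂`: `(1, √c)` is linearly independent by `norm_combo`). [cite: NeukirchANT1999, Ch. II (4.8)] -/
theorem DyadicDiffTwo.exists_subfield (c : ℚ_[2]) (hc : ‖c‖ = 1) (hc1 : ‖1 + c‖ ≤ 4⁻¹) :
    ∃ (E : IntermediateField ℚ_[2] (PadicAlgCl 2)) (π : E), FiniteDimensional ℚ_[2] E ∧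
      Module.finrank ℚ_[2] E = 2 ∧ π ^ 2 = algebraMap ℚ_[2] E c := by
  obtain ⟨α, hα⟩ := IsAlgClosed.exists_pow_nat_eq (algebraMap ℚ_[2] (PadicAlgCl 2) c) (by norm_num : 0 < 2)
  have heval : Polynomial.aeval α (X ^ 2 - C c) = 0 := by
    rw [map_sub, aeval_X_pow, aeval_C, hα, sub_self]
  have hint : IsIntegral ℚ_[2] α := ⟨X ^ 2 - C c, monic_X_pow_sub_C _ (by norm_num), by
    simpa [Polynomial.aeval_def] using heval⟩
  haveI hfd : FiniteDimensional ℚ_[2] ℚ_[2]⟮α⟯ := adjoin.finiteDimensional hint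
  have hπE : (⟨α, mem_adjoin_simple_self ℚ_[2] α⟩ : ℚ_[2]⟮α⟯) ^ 2 = algebraMap ℚ_[2] ℚ_[2]⟮α⟯ c := by
    apply Subtype.ext
    have hcE : ((algebraMap ℚ_[2] ℚ_[2]⟮α⟯ c : ℚ_[2]⟮α⟯) : PadicAlgCl 2) = algebraMap ℚ_[2] (PadicAlgCl 2) c :=
      (IsScalarTower.algebraMap_apply ℚ_[2] ℚ_[2]⟮α⟯ (PadicAlgCl 2) c).symm
    rw [hcE, ← hα]
    rfl
  refine ⟨ℚ_[2]⟮α⟯, ⟨α, mem_adjoin_simple_self ℚ_[2] α⟩, hfd, le_antisymm ?_ ?_, hπE⟩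
  · rw [adjoin.finrank hint]
    have hdvd : minpoly ℚ_[2] α ∣ X ^ 2 - C c := minpoly.dvd ℚ_[2] α heval
    have hne : (X ^ 2 - C c) ≠ 0 := (monic_X_pow_sub_C _ (by norm_num)).ne_zero
    calc (minpoly ℚ_[2] α).natDegree ≤ (X ^ 2 - C c).natDegree := natDegree_le_of_dvd hdvd hne
      _ = 2 := natDegree_X_pow_sub_C
  · have hli := DyadicDiffTwo.linearIndependent_one_pi (K := ℚ_[2]⟮α⟯) hπE hc hc1
    simpa using hli.fintype_card_le_finrank

/-- **NON-VACUITY: AT `ℚ₂(√c)` (`‖c‖ = 1`, `‖1 + c‖ ≤ ¼`; e.g. `ℚ₂(√−1)`, `ℚ₂(√3)` — WILDLY ramified, `e = 2`, `f = 1`,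
different `(2)`) FACTORWISE ISOMETRIES FIX THE MAXIMAL ORDER**: there is a finite `E ⊆ ℚ̄₂`, `[E : ℚ₂] = 2`, `E ∋ √c`,
such that for ALL `ℚ₂`-linear isometries `f₀, f₁` of `E` one has `(f₀ ⊗ f₁)((R_I)^∼) = (R_I)^∼` in `E ⊗_{ℚ₂} E` —
contrast `exists_wildQuadratic_isometry_maxOrder_mover` (`ℚ₂(√2)`) and `exists_dyadicCyclotomic_isometry_maxOrder_mover`
(`ℚ₂(ζ₁₂)`, same `e`, same different). [cite: Mochizuki2012, IUTchIV Prop. 1.1 p. 9] [cite: NeukirchANT1999, Ch. II (4.8)] -/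
theorem exists_dyadicDiffTwo_isometry_stable (c : ℚ_[2]) (hc : ‖c‖ = 1) (hc1 : ‖1 + c‖ ≤ 4⁻¹) :
    ∃ (E : IntermediateField ℚ_[2] (PadicAlgCl 2)) (_ : FiniteDimensional ℚ_[2] E),
      Module.finrank ℚ_[2] E = 2 ∧ (∃ π : E, π ^ 2 = algebraMap ℚ_[2] E c) ∧
        ∀ (f : ∀ _ : Fin 2, (E : Type) ≃ₗ[ℚ_[2]] E), (∀ i x, ‖f i x‖ = ‖x‖) →
          (∀ i (r : ℝ), f i '' closedBall (0 : E) r = closedBall 0 r) ∧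
            (PiTensorProduct.congr f :
                PacketAlgebra 2 (fun _ : Fin 2 => (E : Type)) ≃ₗ[ℚ_[2]] PacketAlgebra 2 (fun _ : Fin 2 => (E : Type))) ''
                (normalizedPacket 2 (fun _ : Fin 2 => (E : Type)) :
                  Set (PacketAlgebra 2 (fun _ : Fin 2 => (E : Type)))) =
              (normalizedPacket 2 (fun _ : Fin 2 => (E : Type)) : Set (PacketAlgebra 2 (fun _ : Fin 2 => (E : Type)))) := by
  obtain ⟨E, π, hfd, hK, hπ⟩ := DyadicDiffTwo.exists_subfield c hc hc1
  exact ⟨E, hfd, hK, ⟨π, hπ⟩, fun f hf => ⟨fun i r => image_closedBall_eq_of_norm_map_eq 2 (f i) (hf i) r,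
    DyadicDiffTwo.congr_image_normalizedPacket_eq_of_isometry (K := E) hK hπ hc hc1 f hf⟩⟩

/-- **NON-VACUITY AT `ℚ₂(√−1)`.** [cite: Mochizuki2012, IUTchIV Prop. 1.1 p. 9] [cite: NeukirchANT1999, Ch. II (4.8)] -/
theorem exists_gaussianDyadic_isometry_stable :
    ∃ (E : IntermediateField ℚ_[2] (PadicAlgCl 2)) (_ : FiniteDimensional ℚ_[2] E),
      Module.finrank ℚ_[2] E = 2 ∧ (∃ i : E, i ^ 2 = -1) ∧
        ∀ (f : ∀ _ : Fin 2, (E : Type) ≃ₗ[ℚ_[2]] E), (∀ i x, ‖f i x‖ = ‖x‖) →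
          (∀ i (r : ℝ), f i '' closedBall (0 : E) r = closedBall 0 r) ∧
            (PiTensorProduct.congr f :
                PacketAlgebra 2 (fun _ : Fin 2 => (E : Type)) ≃ₗ[ℚ_[2]] PacketAlgebra 2 (fun _ : Fin 2 => (E : Type))) ''
                (normalizedPacket 2 (fun _ : Fin 2 => (E : Type)) :
                  Set (PacketAlgebra 2 (fun _ : Fin 2 => (E : Type)))) =
              (normalizedPacket 2 (fun _ : Fin 2 => (E : Type)) : Set (PacketAlgebra 2 (fun _ : Fin 2 => (E : Type)))) := by
  obtain ⟨E, hfd, hK, ⟨π, hπ⟩, h⟩ := exists_dyadicDiffTwo_isometry_stable (-1) (by rw [norm_neg, norm_one]) (by norm_num)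
  exact ⟨E, hfd, hK, ⟨π, by rw [hπ, map_neg, map_one]⟩, h⟩

end Literature.IUT.LogVolume

end
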